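import Summits.AtomisticToContinuum.HydrodynamicLimit.Theorems.RelayRaceLocalityNearConstantShortTimeHLTiltL2Defs
import Summits.AtomisticToContinuum.HydrodynamicLimit.Theorems.RelayRaceLocalityNearConstantShortTimeHLBallKernelSchur
import Summits.AtomisticToContinuum.HydrodynamicLimit.Theorems.RelayRaceLocalityNearConstantShortTimeHLPositionLDReduction
import HarnessLib

/-!
# Crux `NearConstantShortTimeHL` (stmt-AtomisticToContinuum-12502), line `small-tilt-domination` (skeleton v16, lead c7):
# registered stub `tl_ballTilt_of_contTilt : ContTiltLogLaplace → BallTiltLogLaplace`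

Support file (`--supports stmt-AtomisticToContinuum-12502`). The `L²` route proves the uniform quadratic log-Laplace bound
`E exp(γ Σᵢ G(xᵢ)) ≤ exp(n (γ ∫ G ρ₁ + C₀ γ² ∫ G² + κ))` of the matched canonical dilute hard-sphere gas for CONTINUOUS
tilts `|G| ≤ 1` (`ContTiltLogLaplace`, `…TiltL2Defs`); the analytic core of the line, `BallTiltLogLaplace`
(`…DensityLDNetDefs`), asks for it for the discontinuous ball-average tilts `G = Σ_j w_j ballKernel ℓ (y_j) ·`,
`ℓ = mesoRadius (n N)`. This file performs the transfer by a ONE-SIDED continuous approximation chosen after all the data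
`(N, ρ₁, J, y, w)` are fixed, which makes it monotone and measure-free:

* §a a tent profile `min 1 (max 0 ((s - d(x, y)) / r))` across the sphere of radius `ℓ` gives, for one centre and one
  signed weight `w`, a continuous MAJORANT of `w · ballKernel ℓ y` that differs from it only on the shell
  `ℓ - r ≤ d < ℓ + r`, by at most `|w| / V_ℓ`; the exact ball volumes (`volume_setOf_euclidDist_lt_T3`) bound its `L¹`
  defect by `8 (r/ℓ) |w|`;
* §b summing over the centres and capping at `1` yields a continuous `G̃` with `G ≤ G̃`, `|G̃| ≤ 1` and
  `∫ (G̃ - G) ≤ δ` for any prescribed `δ > 0` (`tlm_exists_majorant`);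
* §c since `γ > 0` and `G ≤ G̃`, `∫ e^{γ S_G} dμ ≤ ∫ e^{γ S_G̃} dμ` for ANY measure `μ`; the hypothesis at `G̃` with slack
  `κ/2` and the bookkeeping `γ (∫ G̃ρ₁ - ∫ Gρ₁) + C₀ γ² (∫ G̃² - ∫ G²) ≤ (γ η₁/σ³ + 2 C₀ γ²) δ ≤ κ/2` close the bound with
  the SAME constants `η₁, C₀, γ₁` (`tlm_transfer`);
* §d assembly along the admissible family (`pd_eventually`: eventually `0 < ℓ < 1/4`).

References: H.-T. Yau, Lett. Math. Phys. 22 (1991) §2; E. Pulvirenti – D. Tsagkarogiannis, Comm. Math. Phys. 316 (2012)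
Thm 2.1 (the continuous-tilt input); the smoothing step is folklore.
-/

noncomputable section

namespace Summit.AtomisticToContinuum.HydrodynamicLimit.Theorems.NearConstantShortTimeHL

open scoped BigOperators ENNReal
open MeasureTheory Set Filter Topology Finset
open Literature.MathematicalPhysics.KineticTheory Literature.Analysis.FluidPDE
open Summit.AtomisticToContinuum.HydrodynamicLimit.Theorems.KineticWindowGronwallActivityInversion (thermoActivity)

/-! ## §a The tent profile and the one-centre majorant -/

/-- The clamp `min 1 (max 0 t)` is nonnegative. [folklore] -/
theorem tlm_clamp_nonneg (t : ℝ) : 0 ≤ min 1 (max 0 t) :=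
  le_min zero_le_one (le_max_left _ _)

/-- The clamp `min 1 (max 0 t)` is at most one. [folklore] -/
theorem tlm_clamp_le_one (t : ℝ) : min 1 (max 0 t) ≤ 1 :=
  min_le_left _ _

/-- The clamp equals one above one. [folklore] -/
theorem tlm_clamp_eq_one {t : ℝ} (ht : 1 ≤ t) : min 1 (max 0 t) = 1 :=
  min_eq_left (ht.trans (le_max_right _ _))

/-- The clamp vanishes below zero. [folklore] -/
theorem tlm_clamp_eq_zero {t : ℝ} (ht : t ≤ 0) : min 1 (max 0 t) = 0 := by
  rw [max_eq_left ht, min_eq_right zero_le_one]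

/-- **The one-centre majorant, radial form.** For a distance `d`, a radius `ℓ`, a width `r > 0` and a signed weight `w`:
`w 𝟙[d < ℓ] ≤ w⁺ φ₊(d) - w⁻ φ₋(d)` with the outer tent `φ₊ = clamp((ℓ + r - d)/r)` (`= 1` on `d ≤ ℓ`) and the inner tent
`φ₋ = clamp((ℓ - d)/r)` (`= 0` on `d ≥ ℓ`). [folklore] -/
theorem tlm_core_le {d ℓ r : ℝ} (w : ℝ) (hr : 0 < r) :
    w * (if d < ℓ then 1 else 0) ≤
      max w 0 * min 1 (max 0 ((ℓ + r - d) / r)) - max (-w) 0 * min 1 (max 0 ((ℓ - d) / r)) := by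
  have hw := max_zero_sub_max_neg_zero_eq_self w
  have hp : 0 ≤ max w 0 := le_max_right _ _
  have hm : 0 ≤ max (-w) 0 := le_max_right _ _
  split_ifs with hd
  · rw [tlm_clamp_eq_one (show 1 ≤ (ℓ + r - d) / r by rw [le_div_iff₀ hr, one_mul]; linarith), mul_one, mul_one]
    have h1 := mul_le_of_le_one_right hm (tlm_clamp_le_one ((ℓ - d) / r))
    linarith
  · push Not at hd
    rw [tlm_clamp_eq_zero (show (ℓ - d) / r ≤ 0 by rw [div_le_iff₀ hr, zero_mul]; linarith), mul_zero, mul_zero,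
      sub_zero]
    exact mul_nonneg hp (tlm_clamp_nonneg _)

/-- **The defect of the one-centre majorant, radial form**: it lives on the shell `ℓ - r ≤ d < ℓ + r` and is at most `|w|`
there: `(w⁺ φ₊ - w⁻ φ₋) - w 𝟙[d < ℓ] ≤ |w| (𝟙[d < ℓ + r] - 𝟙[d < ℓ - r])`. [folklore] -/
theorem tlm_core_sub_le {d ℓ r : ℝ} (w : ℝ) (hr : 0 < r) :
    max w 0 * min 1 (max 0 ((ℓ + r - d) / r)) - max (-w) 0 * min 1 (max 0 ((ℓ - d) / r)) -
        w * (if d < ℓ then 1 else 0) ≤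
      |w| * ((if d < ℓ + r then 1 else 0) - (if d < ℓ - r then 1 else 0)) := by
  have hw := max_zero_sub_max_neg_zero_eq_self w
  have hp : 0 ≤ max w 0 := le_max_right _ _
  have hm : 0 ≤ max (-w) 0 := le_max_right _ _
  have hpa : max w 0 ≤ |w| := max_le (le_abs_self w) (abs_nonneg w)
  have hma : max (-w) 0 ≤ |w| := max_le (neg_le_abs w) (abs_nonneg w)
  by_cases h1 : d < ℓ - r
  · have h2 : d < ℓ := by linarith
    have h3 : d < ℓ + r := by linarith
    rw [if_pos h2, if_pos h3, if_pos h1,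
      tlm_clamp_eq_one (show 1 ≤ (ℓ + r - d) / r by rw [le_div_iff₀ hr, one_mul]; linarith),
      tlm_clamp_eq_one (show 1 ≤ (ℓ - d) / r by rw [le_div_iff₀ hr, one_mul]; linarith)]
    linarith
  · by_cases h2 : d < ℓ
    · have h3 : d < ℓ + r := by linarith
      rw [if_pos h2, if_pos h3, if_neg h1,
        tlm_clamp_eq_one (show 1 ≤ (ℓ + r - d) / r by rw [le_div_iff₀ hr, one_mul]; linarith)]
      have h4 : 0 ≤ max (-w) 0 * min 1 (max 0 ((ℓ - d) / r)) := mul_nonneg hm (tlm_clamp_nonneg _)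
      linarith
    · push Not at h2
      rw [if_neg (not_lt.2 h2), if_neg h1,
        tlm_clamp_eq_zero (show (ℓ - d) / r ≤ 0 by rw [div_le_iff₀ hr, zero_mul]; linarith)]
      by_cases h3 : d < ℓ + r
      · rw [if_pos h3]
        have h4 := mul_le_of_le_one_right hp (tlm_clamp_le_one ((ℓ + r - d) / r))
        linarith
      · push Not at h3
        rw [if_neg (not_lt.2 h3),
          tlm_clamp_eq_zero (show (ℓ + r - d) / r ≤ 0 by rw [div_le_iff₀ hr, zero_mul]; linarith)]
        linarith

/-- The ball kernel at centre `y` as the normalised indicator of `{x | d(x, y) < ℓ}` (distance written with `x` first).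
[folklore] -/
theorem tlm_ballKernel_eq (ℓ : ℝ) (y x : T3) :
    ballKernel ℓ y x = (4 / 3 * Real.pi * ℓ ^ 3)⁻¹ * (if Torus.euclidDist x y < ℓ then 1 else 0) := by
  rw [bks_ballKernel_comm]
  unfold ballKernel
  rw [mul_ite, mul_one, mul_zero]

/-- **The one-centre majorant dominates** `w · ballKernel ℓ y`. [folklore] -/
theorem tlm_piece_ge {ℓ r : ℝ} (hℓ : 0 < ℓ) (hr : 0 < r) (y x : T3) (w : ℝ) :
    w * ballKernel ℓ y x ≤ (4 / 3 * Real.pi * ℓ ^ 3)⁻¹ *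
      (max w 0 * min 1 (max 0 ((ℓ + r - Torus.euclidDist x y) / r)) -
        max (-w) 0 * min 1 (max 0 ((ℓ - Torus.euclidDist x y) / r))) := by
  rw [tlm_ballKernel_eq, mul_left_comm]
  exact mul_le_mul_of_nonneg_left (tlm_core_le w hr) (by positivity)

/-- **Pointwise defect of the one-centre majorant**: at most `|w| / V_ℓ` on the shell `ℓ - r ≤ d < ℓ + r`, zero elsewhere.
[folklore] -/
theorem tlm_piece_sub_le {ℓ r : ℝ} (hℓ : 0 < ℓ) (hr : 0 < r) (y x : T3) (w : ℝ) :
    (4 / 3 * Real.pi * ℓ ^ 3)⁻¹ *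
        (max w 0 * min 1 (max 0 ((ℓ + r - Torus.euclidDist x y) / r)) -
          max (-w) 0 * min 1 (max 0 ((ℓ - Torus.euclidDist x y) / r))) - w * ballKernel ℓ y x ≤
      (4 / 3 * Real.pi * ℓ ^ 3)⁻¹ * |w| *
        ((if Torus.euclidDist x y < ℓ + r then 1 else 0) - (if Torus.euclidDist x y < ℓ - r then 1 else 0)) := by
  rw [tlm_ballKernel_eq]
  have hV : 0 ≤ (4 / 3 * Real.pi * ℓ ^ 3)⁻¹ := by positivity
  have key := mul_le_mul_of_nonneg_left (tlm_core_sub_le (d := Torus.euclidDist x y) (ℓ := ℓ) w hr) hV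
  linarith [key]

/-- The one-centre majorant is continuous (the minimal-image distance to a point is continuous). [folklore] -/
theorem tlm_piece_continuous (ℓ r : ℝ) (y : T3) (w : ℝ) :
    Continuous fun x : T3 => (4 / 3 * Real.pi * ℓ ^ 3)⁻¹ *
      (max w 0 * min 1 (max 0 ((ℓ + r - Torus.euclidDist x y) / r)) -
        max (-w) 0 * min 1 (max 0 ((ℓ - Torus.euclidDist x y) / r))) := by
  have hd := continuous_euclidDist_left y
  refine continuous_const.mul ((continuous_const.mul ?_).sub (continuous_const.mul ?_))
  · exact continuous_const.min (continuous_const.max ((continuous_const.sub hd).div_const r))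
  · exact continuous_const.min (continuous_const.max ((continuous_const.sub hd).div_const r))

/-- The volume of a minimal-image ball as an integral: `∫ 𝟙[d(x, y) < s] dx = (4/3) π s³` for `0 ≤ s < 1/2`. [folklore] -/
theorem tlm_integral_indicator_ball {s : ℝ} (hs0 : 0 ≤ s) (hs : s < 1 / 2) (y : T3) :
    ∫ x : T3, (if Torus.euclidDist x y < s then (1 : ℝ) else 0) = 4 / 3 * Real.pi * s ^ 3 := by
  rw [ballKernel_eq_indicator, integral_indicator (measurableSet_setOf_euclidDist_lt s y), setIntegral_const,
    smul_eq_mul, measureReal_def, volume_setOf_euclidDist_lt_T3 hs0 hs y, ENNReal.toReal_ofReal (by positivity),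
    mul_one]

/-- **`L¹` defect of the one-centre majorant**: `∫ (majorant - w · ballKernel ℓ y) ≤ 8 (r/ℓ) |w|` for `0 < r ≤ ℓ`,
`ℓ + r < 1/2` (shell volume `(4/3)π((ℓ + r)³ - (ℓ - r)³) ≤ (4/3)π · 8 ℓ² r`). [folklore] -/
theorem tlm_piece_integral_le {ℓ r : ℝ} (hℓ : 0 < ℓ) (hr : 0 < r) (hrℓ : r ≤ ℓ) (hℓr : ℓ + r < 1 / 2) (y : T3)
    (w : ℝ) :
    ∫ x : T3, ((4 / 3 * Real.pi * ℓ ^ 3)⁻¹ *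
        (max w 0 * min 1 (max 0 ((ℓ + r - Torus.euclidDist x y) / r)) -
          max (-w) 0 * min 1 (max 0 ((ℓ - Torus.euclidDist x y) / r))) - w * ballKernel ℓ y x) ≤
      8 * (r / ℓ) * |w| := by
  have hπ : 0 < Real.pi := Real.pi_pos
  calc ∫ x : T3, ((4 / 3 * Real.pi * ℓ ^ 3)⁻¹ *
        (max w 0 * min 1 (max 0 ((ℓ + r - Torus.euclidDist x y) / r)) -
          max (-w) 0 * min 1 (max 0 ((ℓ - Torus.euclidDist x y) / r))) - w * ballKernel ℓ y x)
      ≤ ∫ x : T3, (4 / 3 * Real.pi * ℓ ^ 3)⁻¹ * |w| *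
          ((if Torus.euclidDist x y < ℓ + r then 1 else 0) - (if Torus.euclidDist x y < ℓ - r then 1 else 0)) :=
        integral_mono ((integrable_of_continuous_T3 (tlm_piece_continuous ℓ r y w)).sub
          ((bks_integrable_ballKernel_right ℓ y).const_mul w))
          (((integrable_ballKernel (ℓ + r) 1 y).sub (integrable_ballKernel (ℓ - r) 1 y)).const_mul _)
          fun x => tlm_piece_sub_le hℓ hr y x w
    _ = (4 / 3 * Real.pi * ℓ ^ 3)⁻¹ * |w| * (4 / 3 * Real.pi * (ℓ + r) ^ 3 - 4 / 3 * Real.pi * (ℓ - r) ^ 3) := by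
        rw [integral_const_mul, integral_sub (integrable_ballKernel (ℓ + r) 1 y) (integrable_ballKernel (ℓ - r) 1 y),
          tlm_integral_indicator_ball (by linarith) hℓr y,
          tlm_integral_indicator_ball (by linarith) (by linarith) y]
    _ = |w| * (((ℓ + r) ^ 3 - (ℓ - r) ^ 3) / ℓ ^ 3) := by
        field_simp
    _ ≤ |w| * (8 * (r / ℓ)) := by
        gcongr
        rw [div_le_iff₀ (pow_pos hℓ 3)]
        have h1 : r ^ 2 ≤ ℓ ^ 2 := pow_le_pow_left₀ hr.le hrℓ 2
        have h2 : (ℓ + r) ^ 3 - (ℓ - r) ^ 3 = 2 * r * (3 * ℓ ^ 2 + r ^ 2) := by ring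
        have h3 : 8 * (r / ℓ) * ℓ ^ 3 = 2 * r * (4 * ℓ ^ 2) := by
          field_simp
          ring
        rw [h2, h3]
        gcongr
        linarith
    _ = 8 * (r / ℓ) * |w| := by ring

/-! ## §b The continuous one-sided approximation of a signed combination of ball kernels -/

/-- **Majorant from pieces.** If each `w_j · ballKernel ℓ (y_j)` has a continuous majorant `P_j` with `L¹` defect
`≤ B |w_j|`, and `|Σ_j w_j ballKernel ℓ (y_j)| ≤ 1`, then `G̃ = min 1 (Σ_j P_j)` is continuous, `G ≤ G̃`, `|G̃| ≤ 1` and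
`∫ (G̃ - G) ≤ B Σ_j |w_j|`. [folklore] -/
theorem tlm_majorant_of_pieces {ℓ : ℝ} {J : ℕ} (y : Fin J → T3) (w : Fin J → ℝ) (P : Fin J → T3 → ℝ)
    (hPc : ∀ j, Continuous (P j)) (hPge : ∀ j x, w j * ballKernel ℓ (y j) x ≤ P j x) {B : ℝ}
    (hPint : ∀ j, ∫ x, (P j x - w j * ballKernel ℓ (y j) x) ≤ B * |w j|)
    (hG : ∀ x, |∑ j, w j * ballKernel ℓ (y j) x| ≤ 1) :
    ∃ Gt : T3 → ℝ, Continuous Gt ∧ (∀ x, ∑ j, w j * ballKernel ℓ (y j) x ≤ Gt x) ∧ (∀ x, |Gt x| ≤ 1) ∧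
      ∫ x, (Gt x - ∑ j, w j * ballKernel ℓ (y j) x) ≤ B * ∑ j, |w j| := by
  have hGi : Integrable fun x => ∑ j, w j * ballKernel ℓ (y j) x :=
    integrable_finsetSum _ fun j _ => (bks_integrable_ballKernel_right ℓ (y j)).const_mul (w j)
  have hSc : Continuous fun x => ∑ j, P j x := continuous_finsetSum _ fun j _ => hPc j
  have hTc : Continuous fun x => min 1 (∑ j, P j x) := continuous_const.min hSc
  have hle : ∀ x, ∑ j, w j * ballKernel ℓ (y j) x ≤ ∑ j, P j x := fun x =>
    Finset.sum_le_sum fun j _ => hPge j x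
  refine ⟨fun x => min 1 (∑ j, P j x), hTc, fun x => le_min ((le_abs_self _).trans (hG x)) (hle x),
    fun x => ?_, ?_⟩
  · rw [abs_le]
    exact ⟨le_min (by norm_num) ((neg_le_of_abs_le (hG x)).trans (hle x)), min_le_left _ _⟩
  · calc ∫ x, (min 1 (∑ j, P j x) - ∑ j, w j * ballKernel ℓ (y j) x)
        ≤ ∫ x, (∑ j, P j x - ∑ j, w j * ballKernel ℓ (y j) x) :=
          integral_mono ((integrable_of_continuous_T3 hTc).sub hGi) ((integrable_of_continuous_T3 hSc).sub hGi)
            fun x => sub_le_sub_right (min_le_right _ _) _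
      _ = ∫ x, ∑ j, (P j x - w j * ballKernel ℓ (y j) x) := by
          refine integral_congr_ae (Eventually.of_forall fun x => ?_)
          simp only [Finset.sum_sub_distrib]
      _ = ∑ j, ∫ x, (P j x - w j * ballKernel ℓ (y j) x) :=
          integral_finsetSum _ fun j _ =>
            (integrable_of_continuous_T3 (hPc j)).sub ((bks_integrable_ballKernel_right ℓ (y j)).const_mul (w j))
      _ ≤ ∑ j, B * |w j| := Finset.sum_le_sum fun j _ => hPint j
      _ = B * ∑ j, |w j| := (Finset.mul_sum _ _ _).symm

/-- **Continuous one-sided `L¹` approximation of a signed combination of ball kernels.** For `0 < ℓ < 1/4`, centres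
`y_j`, weights `w_j` with `|G| ≤ 1`, `G = Σ_j w_j ballKernel ℓ (y_j) ·`, and every `δ > 0` there is a continuous `G̃` with
`G ≤ G̃`, `|G̃| ≤ 1` and `∫ (G̃ - G) ≤ δ` (tent width `r = min (ℓ/2) (δ ℓ / (8 (Σ_j |w_j| + 1)))`). [folklore] -/
theorem tlm_exists_majorant {ℓ : ℝ} (hℓ0 : 0 < ℓ) (hℓ4 : ℓ < 1 / 4) {J : ℕ} (y : Fin J → T3) (w : Fin J → ℝ)
    (hG : ∀ x, |∑ j, w j * ballKernel ℓ (y j) x| ≤ 1) {δ : ℝ} (hδ : 0 < δ) :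
    ∃ Gt : T3 → ℝ, Continuous Gt ∧ (∀ x, ∑ j, w j * ballKernel ℓ (y j) x ≤ Gt x) ∧ (∀ x, |Gt x| ≤ 1) ∧
      ∫ x, (Gt x - ∑ j, w j * ballKernel ℓ (y j) x) ≤ δ := by
  have hS0 : 0 ≤ ∑ j, |w j| := Finset.sum_nonneg fun j _ => abs_nonneg _
  have hW0 : 0 < ∑ j, |w j| + 1 := by linarith
  obtain ⟨r, hr⟩ : ∃ r : ℝ, r = min (ℓ / 2) (δ * ℓ / (8 * (∑ j, |w j| + 1))) := ⟨_, rfl⟩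
  have hr0 : 0 < r := by rw [hr]; exact lt_min (by positivity) (by positivity)
  have hrℓ : r ≤ ℓ := by rw [hr]; linarith [min_le_left (ℓ / 2) (δ * ℓ / (8 * (∑ j, |w j| + 1)))]
  have hℓr : ℓ + r < 1 / 2 := by rw [hr]; linarith [min_le_left (ℓ / 2) (δ * ℓ / (8 * (∑ j, |w j| + 1)))]
  have hrδ : r / ℓ ≤ δ / (8 * (∑ j, |w j| + 1)) := by
    rw [div_le_iff₀ hℓ0, hr]
    calc min (ℓ / 2) (δ * ℓ / (8 * (∑ j, |w j| + 1))) ≤ δ * ℓ / (8 * (∑ j, |w j| + 1)) := min_le_right _ _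
      _ = δ / (8 * (∑ j, |w j| + 1)) * ℓ := by ring
  obtain ⟨Gt, h1, h2, h3, h4⟩ := tlm_majorant_of_pieces y w
    (fun j x => (4 / 3 * Real.pi * ℓ ^ 3)⁻¹ *
      (max (w j) 0 * min 1 (max 0 ((ℓ + r - Torus.euclidDist x (y j)) / r)) -
        max (-w j) 0 * min 1 (max 0 ((ℓ - Torus.euclidDist x (y j)) / r))))
    (fun j => tlm_piece_continuous ℓ r (y j) (w j)) (fun j x => tlm_piece_ge hℓ0 hr0 (y j) x (w j))
    (fun j => tlm_piece_integral_le hℓ0 hr0 hrℓ hℓr (y j) (w j)) hG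
  refine ⟨Gt, h1, h2, h3, h4.trans ?_⟩
  calc 8 * (r / ℓ) * ∑ j, |w j| ≤ 8 * (δ / (8 * (∑ j, |w j| + 1))) * (∑ j, |w j| + 1) := by
        gcongr
        linarith
    _ = δ := by
        field_simp

/-! ## §c The monotone transfer at fixed data -/

/-- **Transfer of the log-Laplace bound along a one-sided `L¹` approximation**, for an arbitrary measure `μ` on
configurations: if `G ≤ G̃` pointwise, `|G|, |G̃| ≤ 1`, `∫ (G̃ - G) ≤ δ`, `0 ≤ ρ₁ ≤ A`, and
`(γ A + 2 C₀ γ²) δ ≤ κ/2`, then the bound for `G̃` with slack `κ/2` implies the bound for `G` with slack `κ`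
(`e^{γ S_G} ≤ e^{γ S_G̃}` pointwise; `∫ G̃ρ₁ - ∫ Gρ₁ ≤ A δ`; `∫ G̃² - ∫ G² ≤ 2δ`). [folklore] -/
theorem tlm_transfer {m : ℕ} (μ : Measure (Fin m → T3)) {γ C₀ κ A δ : ℝ} (hγ : 0 < γ) (hC₀ : 0 < C₀) (hA : 0 ≤ A)
    {ρ₁ G Gt : T3 → ℝ} (hρc : Continuous ρ₁) (hρ0 : ∀ x, 0 ≤ ρ₁ x) (hρA : ∀ x, ρ₁ x ≤ A)
    (hGi : Integrable G) (hGtc : Continuous Gt) (hGle : ∀ x, G x ≤ Gt x) (hG1 : ∀ x, |G x| ≤ 1)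
    (hGt1 : ∀ x, |Gt x| ≤ 1) (hD : ∫ x, (Gt x - G x) ≤ δ) (hδ : (γ * A + 2 * C₀ * γ ^ 2) * δ ≤ κ / 2)
    (hB : ∫⁻ x, ENNReal.ofReal (Real.exp (γ * ∑ i, Gt (x i))) ∂μ ≤
      ENNReal.ofReal (Real.exp ((m : ℝ) * (γ * (∫ x, Gt x * ρ₁ x) + C₀ * γ ^ 2 * (∫ x, Gt x ^ 2) + κ / 2)))) :
    ∫⁻ x, ENNReal.ofReal (Real.exp (γ * ∑ i, G (x i))) ∂μ ≤
      ENNReal.ofReal (Real.exp ((m : ℝ) * (γ * (∫ x, G x * ρ₁ x) + C₀ * γ ^ 2 * (∫ x, G x ^ 2) + κ))) := by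
  have hGti : Integrable Gt := integrable_of_continuous_T3 hGtc
  have hdiff : Integrable fun x => Gt x - G x := hGti.sub hGi
  -- the linear term
  have h1 : (∫ x, Gt x * ρ₁ x) - (∫ x, G x * ρ₁ x) ≤ A * δ := by
    have hb : ∀ᵐ x ∂(volume : Measure T3), ‖ρ₁ x‖ ≤ A := Eventually.of_forall fun x => by
      rw [Real.norm_eq_abs, abs_of_nonneg (hρ0 x)]; exact hρA x
    have hi1 : Integrable fun x => Gt x * ρ₁ x := hGti.mul_bdd hρc.aestronglyMeasurable hb
    have hi2 : Integrable fun x => G x * ρ₁ x := hGi.mul_bdd hρc.aestronglyMeasurable hb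
    rw [← integral_sub hi1 hi2]
    calc ∫ x, (Gt x * ρ₁ x - G x * ρ₁ x) ≤ ∫ x, A * (Gt x - G x) := by
          refine integral_mono (hi1.sub hi2) (hdiff.const_mul A) fun x => ?_
          have h := mul_le_mul_of_nonneg_left (hρA x) (sub_nonneg.2 (hGle x))
          show Gt x * ρ₁ x - G x * ρ₁ x ≤ A * (Gt x - G x)
          linarith
      _ = A * ∫ x, (Gt x - G x) := integral_const_mul _ _
      _ ≤ A * δ := mul_le_mul_of_nonneg_left hD hA
  -- the quadratic term
  have h2 : (∫ x, Gt x ^ 2) - (∫ x, G x ^ 2) ≤ 2 * δ := by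
    have hq1 : Integrable fun x => Gt x ^ 2 := integrable_of_continuous_T3 (hGtc.pow 2)
    have hq2 : Integrable fun x => G x ^ 2 := by
      have h := hGi.mul_bdd hGi.aestronglyMeasurable
        (Eventually.of_forall fun x => (show ‖G x‖ ≤ 1 by rw [Real.norm_eq_abs]; exact hG1 x))
      simpa only [sq] using h
    rw [← integral_sub hq1 hq2]
    calc ∫ x, (Gt x ^ 2 - G x ^ 2) ≤ ∫ x, 2 * (Gt x - G x) := by
          refine integral_mono (hq1.sub hq2) (hdiff.const_mul 2) fun x => ?_
          have hs : Gt x + G x ≤ 2 := by linarith [(abs_le.1 (hG1 x)).2, (abs_le.1 (hGt1 x)).2]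
          have h := mul_le_mul_of_nonneg_left hs (sub_nonneg.2 (hGle x))
          show Gt x ^ 2 - G x ^ 2 ≤ 2 * (Gt x - G x)
          nlinarith [h]
      _ = 2 * ∫ x, (Gt x - G x) := integral_const_mul _ _
      _ ≤ 2 * δ := by linarith
  -- assembly
  calc ∫⁻ x, ENNReal.ofReal (Real.exp (γ * ∑ i, G (x i))) ∂μ
      ≤ ∫⁻ x, ENNReal.ofReal (Real.exp (γ * ∑ i, Gt (x i))) ∂μ :=
        lintegral_mono fun x => ENNReal.ofReal_le_ofReal (Real.exp_le_exp.2
          (mul_le_mul_of_nonneg_left (Finset.sum_le_sum fun i _ => hGle (x i)) hγ.le))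
    _ ≤ ENNReal.ofReal (Real.exp ((m : ℝ) * (γ * (∫ x, Gt x * ρ₁ x) + C₀ * γ ^ 2 * (∫ x, Gt x ^ 2) + κ / 2))) := hB
    _ ≤ ENNReal.ofReal (Real.exp ((m : ℝ) * (γ * (∫ x, G x * ρ₁ x) + C₀ * γ ^ 2 * (∫ x, G x ^ 2) + κ))) := by
        refine ENNReal.ofReal_le_ofReal (Real.exp_le_exp.2 (mul_le_mul_of_nonneg_left ?_ (Nat.cast_nonneg m)))
        have e1 := mul_le_mul_of_nonneg_left h1 hγ.le
        have e2 := mul_le_mul_of_nonneg_left h2 (by positivity : (0 : ℝ) ≤ C₀ * γ ^ 2)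
        linarith [e1, e2, hδ]

/-! ## §d Assembly -/

/-- **Ball-average tilts from continuous tilts** (registered stub `tl_ballTilt_of_contTilt` of line `small-tilt-domination`):
the uniform quadratic log-Laplace bound for continuous tilts `|G| ≤ 1` under the matched canonical dilute hard-sphere Gibbs
measure (`ContTiltLogLaplace`) implies the same bound, with the same threshold `η₁` and the same constants `C₀, γ₁`, for the
ball-average tilts `Σ_j w_j ballKernel ℓ_{n_N} (y_j) ·` of `BallTiltLogLaplace`. Proof: eventually `0 < ℓ_{n_N} < 1/4`
(`pd_eventually`); at fixed data replace `G` by its continuous one-sided `L¹` approximation `G̃ ≥ G` at defect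
`δ = κ / (2 (γ η₁/σ³ + 2 C₀ γ² + 1))` (`tlm_exists_majorant`), apply the hypothesis to `G̃` with slack `κ/2` (the activity
of `BallTiltLogLaplace` is `thermoActivity σ ρ₁`, `thermoActivity_eq_fun`), and transfer (`tlm_transfer`).
[cite: Yau1991, §2] -/
theorem tl_ballTilt_of_contTilt : ContTiltLogLaplace → BallTiltLogLaplace := by
  rintro ⟨η₁, hη₁, hC⟩
  rw [ballTiltLogLaplace_iff]
  refine ⟨η₁, hη₁, fun M hM σ hσ ε n hε hε0 hnε => ?_⟩
  obtain ⟨C₀, hC₀, γ₁, hγ₁, hCγ⟩ := hC M hM σ hσ ε n hε hε0 hnε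
  refine ⟨C₀, hC₀, γ₁, hγ₁, fun γ hγ hγ1 κ hκ => ?_⟩
  filter_upwards [hCγ γ hγ hγ1 (κ / 2) (half_pos hκ), pd_eventually hσ hε hε0 hnε 0 one_pos] with N hN hE
  obtain ⟨-, hℓ0, -, h13, -, -⟩ := hE
  intro ρ₁ hρc hρ1 hρbd hρLip J y w hG
  have hℓ4 : mesoRadius (n N) < 1 / 4 := by linarith
  have hσ3 : 0 < σ ^ 3 := pow_pos hσ 3
  have hM0 : 0 < M := by linarith
  have hρ0 : ∀ x, 0 ≤ ρ₁ x := fun x => (inv_pos.2 hM0).le.trans (hρbd x).1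
  have hρA : ∀ x, ρ₁ x ≤ η₁ / σ ^ 3 := fun x => by rw [le_div_iff₀ hσ3]; exact (hρbd x).2
  have hA0 : 0 ≤ η₁ / σ ^ 3 := by positivity
  have hδ0 : 0 < κ / (2 * (γ * (η₁ / σ ^ 3) + 2 * C₀ * γ ^ 2 + 1)) := by positivity
  have hLδ : (γ * (η₁ / σ ^ 3) + 2 * C₀ * γ ^ 2) * (κ / (2 * (γ * (η₁ / σ ^ 3) + 2 * C₀ * γ ^ 2 + 1))) ≤ κ / 2 := by
    rw [mul_div_assoc', div_le_div_iff₀ (by positivity) (by norm_num : (0 : ℝ) < 2)]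
    have hL0 : 0 ≤ γ * (η₁ / σ ^ 3) + 2 * C₀ * γ ^ 2 := by positivity
    nlinarith [hL0, hκ]
  obtain ⟨Gt, hGtc, hGle, hGt1, hD⟩ := tlm_exists_majorant hℓ0 hℓ4 y w hG hδ0
  have hGi : Integrable fun x => ∑ j, w j * ballKernel (mesoRadius (n N)) (y j) x :=
    integrable_finsetSum _ fun j _ => (bks_integrable_ballKernel_right (mesoRadius (n N)) (y j)).const_mul (w j)
  have hB := hN ρ₁ hρc hρ1 hρbd hρLip Gt hGtc hGt1
  rw [thermoActivity_eq_fun] at hB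
  exact tlm_transfer (G := fun x => ∑ j, w j * ballKernel (mesoRadius (n N)) (y j) x) _ hγ hC₀ hA0 hρc hρ0 hρA
    hGi hGtc hGle hG hGt1 hD hLδ hB

end Summit.AtomisticToContinuum.HydrodynamicLimit.Theorems.NearConstantShortTimeHL

end
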